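import Summits.NavierStokesRegularity.FunctionalMining.TopEigMixDensity
import HarnessLib

/-!
# The strain moment along the heat line: convexity, the tangent inequality and the nonlinear
# Poincaré constant `npConst q` (part 2 of 3 of the heat side of K1-Q6 escape (a))

NS FUNCTIONAL MINING — search for candidate a priori estimates; no regularity claim.

For real `q > 2` and a smooth field `v` on `T³` with strain `S = strainFlat v`: the line function
`t ↦ Z_q(v + t·w)` is convex (`convexOn_strainMoment_line`); its increment from `t = 0` is bounded
below through the pointwise tangent inequality of `x ↦ (‖x‖²)^{q/2}` (`norm_sq_rpow_sub_le`) by the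
pairing `strainLinePairing q v w = q ∫ ‖S‖^{q−2} ⟪S, strainFlat w⟫` (`strainMoment_line_sub_le`),
continuous in `t` along the line (`continuous_strainLinePairing`); at `w = Δv` the pairing is
`≤ −q · strainGradDissipation q v`, `strainGradDissipation q v = ∫ ‖S‖^{q−2} Σₖ‖∂ₖS‖²`
(`strainLinePairing_laplacian_zero_le`, from the TREE
`GradientTensor.integral_rpow_mul_sum_strain_laplacian_le`); and the codomain nonlinear Poincaré
inequality of the TREE (`CodomainNP.integral_norm_rpow_le_weighted`, exponent `q/2 − 1 > 0`, the
mean-zero field `strainFlat v` of a divergence-free `v`) gives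
**`Z_q(v) ≤ npConst q · strainGradDissipation q v`** (`strainMoment_le_npConst_mul`) with
`npConst q = 6(1 + (3^{q/2})²)(q/2)²·27`. `q = 2` is not covered. Field inequalities only; nothing
about Navier–Stokes regularity or blow-up. Census-2 (cell `pub-nsfunc`), kernel-checked; STAGED;
imports part 1 under its proposed tree name. [ours, bookkeeping; K1-Q6 (a), heat side, part 2/3]
FILING (prove seat g25, REQUEST #17 part 2/3): census-2's `lean/mixlaw/v2/split/TopEigStrainHeatLine.lean` ee9d43d37eb5004e, declarations byte-identical; one one-line docstring (`npConst_pos`) and this line added for the gate's lints.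
-/

open MeasureTheory Set Filter Topology Finset
open scoped InnerProductSpace RealInnerProductSpace ContDiff

namespace Summit.NavierStokesRegularity.FunctionalMining

open Literature.Analysis.FunctionSpaces Literature.Analysis.FunctionSpaces.Torus
  Literature.Analysis.FluidPDE

namespace TopEig

open StrainL4 StrainMoment

/-! ## 3. The tangent inequality for `s ↦ s^p` and for `x ↦ (|x|²)^{q/2}` -/

/-- Tangent line of the convex `s ↦ s^p` (`p > 1`) on `[0, ∞)`: `X^p − Y^p ≤ p X^{p−1} (X − Y)`.
[folklore: Bernoulli `one_add_mul_self_le_rpow_one_add`] -/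
theorem rpow_sub_rpow_le_tangent {p : ℝ} (hp : 1 < p) {X Y : ℝ} (hX : 0 ≤ X) (hY : 0 ≤ Y) :
    X ^ p - Y ^ p ≤ p * X ^ (p - 1) * (X - Y) := by
  rcases hX.eq_or_lt with h0 | hX0
  · rw [← h0, Real.zero_rpow (by linarith : p ≠ 0), Real.zero_rpow (by linarith : p - 1 ≠ 0)]
    have := Real.rpow_nonneg hY p
    nlinarith
  · have hs : -1 ≤ Y / X - 1 := by linarith [div_nonneg hY hX]
    have h := one_add_mul_self_le_rpow_one_add hs hp.le
    have e1 : 1 + (Y / X - 1) = Y / X := by ring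
    rw [e1, Real.div_rpow hY hX] at h
    have hXp : 0 < X ^ p := Real.rpow_pos_of_pos hX0 p
    have h2 : (1 + p * (Y / X - 1)) * X ^ p ≤ Y ^ p := (le_div_iff₀ hXp).mp h
    have e2 : (1 + p * (Y / X - 1)) * X ^ p = X ^ p + p * X ^ (p - 1) * (Y - X) := by
      rw [Real.rpow_sub_one hX0.ne']
      field_simp
    linarith

/-- **Pointwise tangent inequality** in a real inner product space (`q > 2`, any real `τ`):
`(|x+τy|²)^{q/2} − (|x|²)^{q/2} ≤ τ · q (|x+τy|²)^{q/2−1} ⟨x+τy, y⟩`. [ours] -/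
theorem norm_sq_rpow_sub_le {E : Type*} [NormedAddCommGroup E] [InnerProductSpace ℝ E] {q : ℝ}
    (hq : 2 < q) (x y : E) (τ : ℝ) :
    (‖x + τ • y‖ ^ 2) ^ (q / 2) - (‖x‖ ^ 2) ^ (q / 2) ≤
      τ * (q * (‖x + τ • y‖ ^ 2) ^ (q / 2 - 1) * ⟪x + τ • y, y⟫_ℝ) := by
  have hp : 1 < q / 2 := by linarith
  have h1 := rpow_sub_rpow_le_tangent hp (sq_nonneg ‖x + τ • y‖) (sq_nonneg ‖x‖)
  have h2 : ‖x + τ • y‖ ^ 2 - ‖x‖ ^ 2 ≤ 2 * τ * ⟪x + τ • y, y⟫_ℝ := by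
    have e : ‖x‖ ^ 2 = ‖x + τ • y‖ ^ 2 - 2 * (τ * ⟪x + τ • y, y⟫_ℝ) + (|τ| * ‖y‖) ^ 2 := by
      have h := norm_sub_sq_real (x + τ • y) (τ • y)
      rw [add_sub_cancel_right, real_inner_smul_right, norm_smul, Real.norm_eq_abs] at h
      exact h
    rw [mul_pow, sq_abs] at e
    nlinarith [mul_nonneg (sq_nonneg τ) (sq_nonneg ‖y‖)]
  have h3 : 0 ≤ q / 2 * (‖x + τ • y‖ ^ 2) ^ (q / 2 - 1) :=
    mul_nonneg (by linarith) (Real.rpow_nonneg (sq_nonneg _) _)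
  calc (‖x + τ • y‖ ^ 2) ^ (q / 2) - (‖x‖ ^ 2) ^ (q / 2)
      ≤ q / 2 * (‖x + τ • y‖ ^ 2) ^ (q / 2 - 1) * (‖x + τ • y‖ ^ 2 - ‖x‖ ^ 2) := h1
    _ ≤ q / 2 * (‖x + τ • y‖ ^ 2) ^ (q / 2 - 1) * (2 * τ * ⟪x + τ • y, y⟫_ℝ) :=
        mul_le_mul_of_nonneg_left h2 h3
    _ = τ * (q * (‖x + τ • y‖ ^ 2) ^ (q / 2 - 1) * ⟪x + τ • y, y⟫_ℝ) := by ring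

/-- `⟨S(x), S(Δv)(x)⟩ = ∑ᵢⱼ Sᵢⱼ (∂ᵢΔv)ⱼ` (symmetry of `S`). [ours, bookkeeping] -/
theorem inner_strainFlat_laplacian (v : UnitAddTorus (Fin 3) → EuclideanSpace ℝ (Fin 3))
    (x : UnitAddTorus (Fin 3)) :
    ⟪strainFlat v x, strainFlat (Torus.laplacian v) x⟫_ℝ =
      ∑ i, ∑ j, (Torus.partialDeriv j v x i + Torus.partialDeriv i v x j) / 2 *
        Torus.partialDeriv i (Torus.laplacian v) x j := by
  rw [GradientTensor.sum_symm_mul_eq_sum_symm_mul_symmPart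
    (fun i j => (Torus.partialDeriv j v x i + Torus.partialDeriv i v x j) / 2)
    (fun i j => Torus.partialDeriv i (Torus.laplacian v) x j) (fun i j => by ring)]
  simp only [PiLp.inner_apply, Fintype.sum_prod_type, strainFlat_apply]
  refine Finset.sum_congr rfl fun i _ => Finset.sum_congr rfl fun j _ => ?_
  simp [mul_comm]

/-! ## 4. Heat coercivity of the normalised mixture `α Φ_q + β Z_q` -/

/-- The nonlinear-Poincaré constant `C_NP(q) = 6(1 + 3^{2(1+a)})(1+a)² 3³` at `a = q/2 − 1`, `d = 3`
(`CodomainNP.integral_norm_rpow_le_weighted`). [ours, bookkeeping] -/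
noncomputable def npConst (q : ℝ) : ℝ :=
  6 * (1 + ((3 : ℝ) ^ (1 + (q / 2 - 1))) ^ 2) * (1 + (q / 2 - 1)) ^ 2 * (3 : ℝ) ^ 3

/-- `0 < npConst q` (`q > 2`). [ours, bookkeeping; docstring added at filing] -/
theorem npConst_pos {q : ℝ} (hq : 2 < q) : 0 < npConst q := by
  unfold npConst
  have : 0 < 1 + (q / 2 - 1) := by linarith
  positivity

/-- The strain moment along a line: `Z_q(v + t w) = ∫ (|S(v) + t S(w)|²)^{q/2}`. [ours, bookkeeping] -/
theorem strainMoment_line_eq (q : ℝ) {v w : UnitAddTorus (Fin 3) → EuclideanSpace ℝ (Fin 3)}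
    (hv : Torus.IsSmooth v) (hw : Torus.IsSmooth w) (t : ℝ) :
    torusStrainMoment q (v + t • w) =
      ∫ x, (‖strainFlat v x + t • strainFlat w x‖ ^ 2) ^ (q / 2) := by
  show (∫ x, torusStrainSqAt (v + t • w) x ^ (q / 2)) = _
  refine integral_congr_ae (ae_of_all _ fun x => ?_)
  show torusStrainSqAt (v + t • w) x ^ (q / 2) = (‖strainFlat v x + t • strainFlat w x‖ ^ 2) ^ (q / 2)
  rw [← norm_strainFlat_sq, strainFlat_add_smul (hv.isContDiff (by simp)) (hw.isContDiff (by simp))]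

/-- **`t ↦ Z_q(v + t w)` is convex** for smooth `v, w` and `q ≥ 1`. [ours] -/
theorem convexOn_strainMoment_line {q : ℝ} (hq : 1 ≤ q)
    {v w : UnitAddTorus (Fin 3) → EuclideanSpace ℝ (Fin 3)} (hv : Torus.IsSmooth v)
    (hw : Torus.IsSmooth w) : ConvexOn ℝ univ (fun t : ℝ => torusStrainMoment q (v + t • w)) := by
  have h := convexOn_integral_posPart_rpow_line (d := Fin 3)
    (g := fun A : EuclideanSpace ℝ (Fin 3 × Fin 3) => ‖A‖) convexOn_univ_norm continuous_norm
    (continuous_strainFlat hv) (continuous_strainFlat hw) hq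
  refine h.congr fun t _ => ?_
  show (∫ x, max ‖strainFlat v x + t • strainFlat w x‖ 0 ^ q) = torusStrainMoment q (v + t • w)
  rw [strainMoment_line_eq q hv hw t]
  refine integral_congr_ae (ae_of_all _ fun x => ?_)
  show max ‖strainFlat v x + t • strainFlat w x‖ 0 ^ q =
    (‖strainFlat v x + t • strainFlat w x‖ ^ 2) ^ (q / 2)
  rw [max_eq_left (norm_nonneg _), ← Real.rpow_natCast, ← Real.rpow_mul (norm_nonneg _)]
  congr 1
  push_cast
  ring

/-- The pairing `ψ(τ) = ∫ q (|S + τB|²)^{q/2−1} ⟨S + τB, B⟩` along a line (`S = S(v)`, `B = S(w)`).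
[ours, bookkeeping] -/
noncomputable def strainLinePairing (q : ℝ) (v w : UnitAddTorus (Fin 3) → EuclideanSpace ℝ (Fin 3))
    (τ : ℝ) : ℝ :=
  ∫ x, q * (‖strainFlat v x + τ • strainFlat w x‖ ^ 2) ^ (q / 2 - 1) *
    ⟪strainFlat v x + τ • strainFlat w x, strainFlat w x⟫_ℝ

/-- `τ ↦ ψ(τ)` is continuous (`q > 2`). [ours] -/
theorem continuous_strainLinePairing {q : ℝ} (hq : 2 < q)
    {v w : UnitAddTorus (Fin 3) → EuclideanSpace ℝ (Fin 3)} (hv : Torus.IsSmooth v)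
    (hw : Torus.IsSmooth w) : Continuous (strainLinePairing q v w) := by
  unfold strainLinePairing
  have hr : 0 ≤ q / 2 - 1 := by linarith
  have hSc := continuous_strainFlat hv
  have hBc := continuous_strainFlat hw
  have hlin : Continuous fun p : ℝ × UnitAddTorus (Fin 3) =>
      strainFlat v p.2 + p.1 • strainFlat w p.2 :=
    (hSc.comp continuous_snd).add (continuous_fst.smul (hBc.comp continuous_snd))
  have hF : Continuous (Function.uncurry fun (τ : ℝ) (x : UnitAddTorus (Fin 3)) =>
      q * (‖strainFlat v x + τ • strainFlat w x‖ ^ 2) ^ (q / 2 - 1) *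
        ⟪strainFlat v x + τ • strainFlat w x, strainFlat w x⟫_ℝ) :=
    (continuous_const.mul ((hlin.norm.pow 2).rpow_const fun _ => Or.inr hr)).mul
      (hlin.inner (hBc.comp continuous_snd))
  have h := continuous_parametric_integral_of_continuous (μ := volume) hF isCompact_univ
  simpa only [Measure.restrict_univ] using h

/-- **Secant-below-tangent for `Z_q` along a line**: `Z_q(v + τw) − Z_q(v) ≤ τ ψ(τ)` for every real
`τ` and `q > 2` (the integrated pointwise tangent inequality at the endpoint `v + τw`). [ours] -/
theorem strainMoment_line_sub_le {q : ℝ} (hq : 2 < q)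
    {v w : UnitAddTorus (Fin 3) → EuclideanSpace ℝ (Fin 3)} (hv : Torus.IsSmooth v)
    (hw : Torus.IsSmooth w) (τ : ℝ) :
    torusStrainMoment q (v + τ • w) - torusStrainMoment q v ≤ τ * strainLinePairing q v w τ := by
  have hr : 0 ≤ q / 2 - 1 := by linarith
  have hSc := continuous_strainFlat hv
  have hBc := continuous_strainFlat hw
  have hlin : ∀ t : ℝ, Continuous fun x => strainFlat v x + t • strainFlat w x := fun t =>
    hSc.add ((continuous_const (y := t)).smul hBc)
  have hcq : ∀ t : ℝ, Continuous fun x => (‖strainFlat v x + t • strainFlat w x‖ ^ 2) ^ (q / 2) :=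
    fun t => ((hlin t).norm.pow 2).rpow_const fun _ => Or.inr (by linarith)
  have hcI : Continuous fun x => q * (‖strainFlat v x + τ • strainFlat w x‖ ^ 2) ^ (q / 2 - 1) *
      ⟪strainFlat v x + τ • strainFlat w x, strainFlat w x⟫_ℝ :=
    (continuous_const.mul (((hlin τ).norm.pow 2).rpow_const fun _ => Or.inr hr)).mul
      ((hlin τ).inner hBc)
  have h0 : torusStrainMoment q v =
      ∫ x, (‖strainFlat v x + (0 : ℝ) • strainFlat w x‖ ^ 2) ^ (q / 2) := by
    rw [← strainMoment_line_eq q hv hw 0, zero_smul, add_zero]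
  rw [strainMoment_line_eq q hv hw τ, h0,
    ← integral_sub (hcq τ).integrable_unitAddTorus (hcq 0).integrable_unitAddTorus]
  unfold strainLinePairing
  rw [← integral_const_mul]
  refine integral_mono ((hcq τ).integrable_unitAddTorus.sub (hcq 0).integrable_unitAddTorus)
    (hcI.integrable_unitAddTorus.const_mul τ) fun x => ?_
  have h := norm_sq_rpow_sub_le hq (strainFlat v x) (strainFlat w x) τ
  simpa only [zero_smul, add_zero] using h

/-- The weighted strain-gradient dissipation `D_Z(v) = ∫ (|S|²)^{q/2−1} ∑ₖ∑ᵢⱼ (∂ₖSᵢⱼ)²`.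
[ours, bookkeeping] -/
noncomputable def strainGradDissipation (q : ℝ) (v : UnitAddTorus (Fin 3) → EuclideanSpace ℝ (Fin 3)) :
    ℝ :=
  ∫ x, torusStrainSqAt v x ^ (q / 2 - 1) * ∑ k, ∑ i, ∑ j,
    ((Torus.partialDeriv k (Torus.partialDeriv j v) x i +
      Torus.partialDeriv k (Torus.partialDeriv i v) x j) / 2) ^ 2

/-- **The sign lemma for the pairing at `τ = 0` along the heat line**: `ψ(0) ≤ −q D_Z(v)`
(`GradientTensor.integral_rpow_mul_sum_strain_laplacian_le` at `r = q/2 − 1`). [ours] -/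
theorem strainLinePairing_laplacian_zero_le {q : ℝ} (hq : 2 < q)
    {v : UnitAddTorus (Fin 3) → EuclideanSpace ℝ (Fin 3)} (hv : Torus.IsSmooth v) :
    strainLinePairing q v (Torus.laplacian v) 0 ≤ -(q * strainGradDissipation q v) := by
  have hr : 0 < q / 2 - 1 := by linarith
  have hq0 : 0 ≤ q := by linarith
  have e : strainLinePairing q v (Torus.laplacian v) 0 =
      q * ∫ x, torusStrainSqAt v x ^ (q / 2 - 1) * ∑ i, ∑ j,
        (Torus.partialDeriv j v x i + Torus.partialDeriv i v x j) / 2 *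
          Torus.partialDeriv i (Torus.laplacian v) x j := by
    unfold strainLinePairing
    rw [← integral_const_mul]
    refine integral_congr_ae (ae_of_all _ fun x => ?_)
    show q * (‖strainFlat v x + (0 : ℝ) • strainFlat (Torus.laplacian v) x‖ ^ 2) ^ (q / 2 - 1) *
        ⟪strainFlat v x + (0 : ℝ) • strainFlat (Torus.laplacian v) x,
          strainFlat (Torus.laplacian v) x⟫_ℝ = _
    rw [zero_smul, add_zero, norm_strainFlat_sq, inner_strainFlat_laplacian]
    ring
  rw [e]
  unfold strainGradDissipation
  have h := GradientTensor.integral_rpow_mul_sum_strain_laplacian_le hv hr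
  have h' := mul_le_mul_of_nonneg_left h hq0
  linarith

/-- **Nonlinear Poincaré for the strain moment**: `Z_q(v) ≤ C_NP(q) D_Z(v)` for smooth `v` on `T³`
and real `q > 2` (`CodomainNP.integral_norm_rpow_le_weighted` at `a = q/2 − 1` for the mean-zero
field `strainFlat v`). [ours] -/
theorem strainMoment_le_npConst_mul {q : ℝ} (hq : 2 < q)
    {v : UnitAddTorus (Fin 3) → EuclideanSpace ℝ (Fin 3)} (hv : Torus.IsSmooth v) :
    torusStrainMoment q v ≤ npConst q * strainGradDissipation q v := by
  have hr : 0 < q / 2 - 1 := by linarith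
  have h := CodomainNP.integral_norm_rpow_le_weighted (d := Fin 3)
    (F := EuclideanSpace ℝ (Fin 3 × Fin 3)) (isSmooth_strainFlat hv) (hasZeroMean_strainFlat hv) hr
  have e1 : ∀ x, ‖strainFlat v x‖ ^ (2 * (q / 2 - 1) + 2) = torusStrainSqAt v x ^ (q / 2) := by
    intro x
    rw [show 2 * (q / 2 - 1) + 2 = q by ring, ← strainSqAt_rpow_half]
  have e2 : ∀ x, ‖strainFlat v x‖ ^ (2 * (q / 2 - 1)) *
      ∑ k, ‖Torus.partialDeriv k (strainFlat v) x‖ ^ 2 =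
      torusStrainSqAt v x ^ (q / 2 - 1) * ∑ k, ∑ i, ∑ j,
        ((Torus.partialDeriv k (Torus.partialDeriv j v) x i +
          Torus.partialDeriv k (Torus.partialDeriv i v) x j) / 2) ^ 2 := by
    intro x
    rw [show 2 * (q / 2 - 1) = q - 2 by ring, ← strainSqAt_rpow_half_sub_one,
      sum_norm_partialDeriv_strainFlat_sq hv]
  simp_rw [e1, e2] at h
  have hcard : (Fintype.card (Fin 3) : ℝ) = 3 := by simp
  rw [hcard] at h
  unfold npConst strainGradDissipation
  show (∫ x, torusStrainSqAt v x ^ (q / 2)) ≤ _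
  exact h

/-- `0 ≤ D_Z`. [ours, bookkeeping] -/
theorem strainGradDissipation_nonneg (q : ℝ) (v : UnitAddTorus (Fin 3) → EuclideanSpace ℝ (Fin 3)) :
    0 ≤ strainGradDissipation q v :=
  integral_nonneg fun x => mul_nonneg (Real.rpow_nonneg (torusStrainSqAt_nonneg v x) _)
    (Finset.sum_nonneg fun _ _ => Finset.sum_nonneg fun _ _ => Finset.sum_nonneg fun _ _ =>
      sq_nonneg _)

end TopEig

end Summit.NavierStokesRegularity.FunctionalMining
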